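import Mathlib
import Summits.Ventures.PercRepro2.UniversalAlignedDefs

/-! # The level-aligned package is closed under series composition — coordinatewise
(seat mine-b, cell pub-perc-repro2; MINE-B.md §29)

Packages `P` on `X` and `Q` on `Y` give a package on the series product `X ∧ Y` (labels `min`):

* the assignment is `serAssignL` (UniversalAlignedDefs.lean): the slot `0` of every product source `(u, v)`
  goes to `(α 0 u, α 0 v)`, the slot `k ≥ 1` of `(x, z)` with `x` a source of `X` to `(f (x, k), α k z)`,
  and the slot `k ≥ 1` of `(u, z)` with `u` red-positive (so `z` a source of `Y`) to `(β k u, g (z, k))`;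
* the level relays are the coordinatewise products `α k (u, v) = (α k u, α k v)` and
  `β k (u, v) = (β k u, β k v)`.

Every avoidance decouples: an image of a slot of index `k' < k` (resp. `≤ k`) has either an `X`-coordinate
that is an `f`-image of a slot of index `≤ k'` or a `Y`-coordinate that is a `g`-image of a slot of index
`≤ k'`, and the factor relays avoid exactly those.  Injectivity of the assignment is the nine kind pairs:
two images of different kinds are separated by a coordinate that is a slot image in one and avoided by a
relay in the other, or by their indices. -/

namespace Summit.Ventures.PercRepro2.UHClosure

open Finset
open Summit.Ventures.PercRepro2.V2Closure (serR serB)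

variable {X Y : Type*} [Preorder X] [Preorder Y] [Fintype X] [Fintype Y]
variable {r b : X → ℕ} {r' b' : Y → ℕ} (P : PackageL r b) (Q : PackageL r' b')

omit [Preorder Y] in
/-- a slot of kind `zero` whose first coordinate is a source: the relay value is the slot-`0` image -/
lemma zero_fst_eq {q : SlotL (USrc (serR r r') (serB b b')) (serB b b')} (hu : r q.1.1.1.1 = 0) :
    P.α 0 q.1.1.1.1 = P.f (mkSlot r b q.1.1.1.1 (zero_fst_src r b r' b' hu) 0
      (ser_src_blue r b r' b' q.1.1.2.1).1) :=
  P.α_src (mkSlot r b q.1.1.1.1 (zero_fst_src r b r' b' hu) 0 (ser_src_blue r b r' b' q.1.1.2.1).1) rfl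

omit [Preorder X] in
/-- a slot of kind `zero` whose second coordinate is a source: the relay value is the slot-`0` image -/
lemma zero_snd_eq {q : SlotL (USrc (serR r r') (serB b b')) (serB b b')} (hv : r' q.1.1.1.2 = 0) :
    Q.α 0 q.1.1.1.2 = Q.f (mkSlot r' b' q.1.1.1.2 (zero_snd_src r b r' b' hv) 0
      (ser_src_blue r b r' b' q.1.1.2.1).2) :=
  Q.α_src (mkSlot r' b' q.1.1.1.2 (zero_snd_src r b r' b' hv) 0 (ser_src_blue r b r' b' q.1.1.2.1).2) rfl

/-- **the series assignment is a (UH*) assignment**: below its source, red label `1`, blue drop `≤ 1` -/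
theorem serAssignL_spec (q : SlotL (USrc (serR r r') (serB b b')) (serB b b')) :
    serAssignL P Q q ≤ q.1.1.1 ∧ serR r r' (serAssignL P Q q) = 1 ∧
      serB b b' q.1.1.1 ≤ serB b b' (serAssignL P Q q) + 1 := by
  have blue := ser_src_blue r b r' b' q.1.1.2.1
  rcases hk : alKind r b r' b' q with _ | _ | _
  · rw [serAssignL_zero P Q hk]
    obtain ⟨l1, r1, d1⟩ := P.α_spec 0 _ blue.1
    obtain ⟨l2, r2, d2⟩ := Q.α_spec 0 _ blue.2
    refine ⟨Prod.mk_le_mk.2 ⟨l1, l2⟩, ?_, ?_⟩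
    · -- one coordinate is a source, whose relay value is its slot `0`, of red label `1`
      rcases ser_src_red r b r' b' q.1.1.2.1 with hu | hv
      · have := (P.f_spec (mkSlot r b q.1.1.1.1 (zero_fst_src r b r' b' hu) 0 blue.1)).2.1
        rw [← zero_fst_eq P hu] at this
        simp only [serR]; omega
      · have := (Q.f_spec (mkSlot r' b' q.1.1.1.2 (zero_snd_src r b r' b' hv) 0 blue.2)).2.1
        rw [← zero_snd_eq Q hv] at this
        simp only [serR]; omega
    · simp only [serB]; omega
  · rw [serAssignL_src P Q hk]
    obtain ⟨l1, r1, d1⟩ := P.f_spec (mkSlot r b q.1.1.1.1 (src_fst_src r b r' b' hk) q.1.2.val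
      (src_idx_lt r b r' b' hk))
    simp only [mkSlot_src] at l1 d1
    obtain ⟨l2, r2, d2⟩ := Q.α_spec q.1.2.val _ (ser_idx_lt r b r' b' q).2
    refine ⟨Prod.mk_le_mk.2 ⟨l1, l2⟩, ?_, ?_⟩
    · simp only [serR]; omega
    · simp only [serB]; omega
  · rw [serAssignL_int P Q hk]
    obtain ⟨l1, r1, d1⟩ := P.β_spec q.1.2.val _ (int_facts r b r' b' hk).1 (ser_idx_lt r b r' b' q).1
    obtain ⟨l2, r2, d2⟩ := Q.f_spec (mkSlot r' b' q.1.1.1.2 (int_snd_src r b r' b' hk) q.1.2.val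
      (int_idx_lt r b r' b' hk))
    simp only [mkSlot_src] at l2 d2
    refine ⟨Prod.mk_le_mk.2 ⟨l1, l2⟩, ?_, ?_⟩
    · simp only [serR]; omega
    · simp only [serB]; omega

/-- a `zero` image and a `src` image never coincide -/
lemma zero_ne_src {q q' : SlotL (USrc (serR r r') (serB b b')) (serB b b')} (hk : alKind r b r' b' q = .zero)
    (hk' : alKind r b r' b' q' = .src) : serAssignL P Q q ≠ serAssignL P Q q' := by
  intro he
  rw [serAssignL_zero P Q hk, serAssignL_src P Q hk'] at he
  obtain ⟨e1, e2⟩ := Prod.mk.inj he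
  have hne := (alKind_src r b r' b' hk').1
  rcases ser_src_red r b r' b' q.1.1.2.1 with hu | hv
  · rw [zero_fst_eq P hu] at e1
    have := (mkSlot_inj r b P.f_inj e1).2
    omega
  · rw [zero_snd_eq Q hv] at e2
    exact Q.α_avoid q'.1.2.val _ (ser_idx_lt r b r' b' q').2 _ (by simp only [mkSlot_idx]; omega) e2.symm

/-- a `zero` image and an `int` image never coincide -/
lemma zero_ne_int {q q' : SlotL (USrc (serR r r') (serB b b')) (serB b b')} (hk : alKind r b r' b' q = .zero)
    (hk' : alKind r b r' b' q' = .int) : serAssignL P Q q ≠ serAssignL P Q q' := by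
  intro he
  rw [serAssignL_zero P Q hk, serAssignL_int P Q hk'] at he
  obtain ⟨e1, e2⟩ := Prod.mk.inj he
  have hne := (alKind_int r b r' b' hk').1
  rcases ser_src_red r b r' b' q.1.1.2.1 with hu | hv
  · rw [zero_fst_eq P hu] at e1
    exact P.β_avoid q'.1.2.val _ (int_facts r b r' b' hk').1 (ser_idx_lt r b r' b' q').1 _
      (by simp only [mkSlot_idx]; exact Nat.zero_le _) e1.symm
  · rw [zero_snd_eq Q hv] at e2
    have := (mkSlot_inj r' b' Q.f_inj e2).2
    omega

/-- a `src` image and an `int` image never coincide -/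
lemma src_ne_int {q q' : SlotL (USrc (serR r r') (serB b b')) (serB b b')} (hk : alKind r b r' b' q = .src)
    (hk' : alKind r b r' b' q' = .int) : serAssignL P Q q ≠ serAssignL P Q q' := by
  intro he
  rw [serAssignL_src P Q hk, serAssignL_int P Q hk'] at he
  obtain ⟨e1, e2⟩ := Prod.mk.inj he
  by_cases hle : q.1.2.val ≤ q'.1.2.val
  · exact P.β_avoid q'.1.2.val _ (int_facts r b r' b' hk').1 (ser_idx_lt r b r' b' q').1 _
      (by simp only [mkSlot_idx]; exact hle) e1.symm
  · exact Q.α_avoid q.1.2.val _ (ser_idx_lt r b r' b' q).2 _ (by simp only [mkSlot_idx]; omega) e2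

/-- **the series assignment is injective** -/
theorem serAssignL_inj : Function.Injective (serAssignL P Q) := by
  intro q q' he
  rcases hk : alKind r b r' b' q with _ | _ | _ <;> rcases hk' : alKind r b r' b' q' with _ | _ | _
  · -- (zero, zero)
    rw [serAssignL_zero P Q hk, serAssignL_zero P Q hk'] at he
    obtain ⟨e1, e2⟩ := Prod.mk.inj he
    have hu := P.α_inj 0 _ _ (ser_src_blue r b r' b' q.1.1.2.1).1 (ser_src_blue r b r' b' q'.1.1.2.1).1 e1
    have hv := Q.α_inj 0 _ _ (ser_src_blue r b r' b' q.1.1.2.1).2 (ser_src_blue r b r' b' q'.1.1.2.1).2 e2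
    exact ser_slot_ext q q' (Prod.ext hu hv) (by rw [alKind_zero r b r' b' hk, alKind_zero r b r' b' hk'])
  · exact absurd he (zero_ne_src P Q hk hk')
  · exact absurd he (zero_ne_int P Q hk hk')
  · exact absurd he.symm (zero_ne_src P Q hk' hk)
  · -- (src, src)
    rw [serAssignL_src P Q hk, serAssignL_src P Q hk'] at he
    obtain ⟨e1, e2⟩ := Prod.mk.inj he
    obtain ⟨hu, hi⟩ := mkSlot_inj r b P.f_inj e1
    rw [← hi] at e2
    have hv := Q.α_inj q.1.2.val _ _ (ser_idx_lt r b r' b' q).2 (hi ▸ (ser_idx_lt r b r' b' q').2) e2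
    exact ser_slot_ext q q' (Prod.ext hu hv) hi
  · exact absurd he (src_ne_int P Q hk hk')
  · exact absurd he.symm (zero_ne_int P Q hk' hk)
  · exact absurd he.symm (src_ne_int P Q hk' hk)
  · -- (int, int)
    rw [serAssignL_int P Q hk, serAssignL_int P Q hk'] at he
    obtain ⟨e1, e2⟩ := Prod.mk.inj he
    obtain ⟨hv, hi⟩ := mkSlot_inj r' b' Q.f_inj e2
    rw [← hi] at e1
    have hu := P.β_inj q.1.2.val _ _ (int_facts r b r' b' hk).1 (ser_idx_lt r b r' b' q).1
      (int_facts r b r' b' hk').1 (hi ▸ (ser_idx_lt r b r' b' q').1) e1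
    exact ser_slot_ext q q' (Prod.ext hu hv) hi

/-! ### The level relays of the product -/

/-- the level relay `α k` of the series product: coordinatewise -/
def serAlpha (k : ℕ) (z : X × Y) : X × Y := (P.α k z.1, Q.α k z.2)

/-- the level relay `β k` of the series product: coordinatewise -/
def serBeta (k : ℕ) (z : X × Y) : X × Y := (P.β k z.1, Q.β k z.2)

omit [Preorder X] [Preorder Y] [Fintype X] [Fintype Y] in
/-- a blue label `> k` of the product: both coordinates `> k` -/
lemma serB_gt {k : ℕ} {z : X × Y} (h : k < serB b b' z) : k < b z.1 ∧ k < b' z.2 := by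
  simp only [serB] at h; omega

omit [Preorder X] [Preorder Y] [Fintype X] [Fintype Y] in
/-- a red label `≥ 1` of the product: both coordinates `≥ 1` -/
lemma serR_pos {z : X × Y} (h : 1 ≤ serR r r' z) : 1 ≤ r z.1 ∧ 1 ≤ r' z.2 := by
  simp only [serR] at h; omega

/-- `serAlpha k` is injective on `{b > k}` -/
theorem serAlpha_inj (k : ℕ) (z z' : X × Y) (hz : k < serB b b' z) (hz' : k < serB b b' z')
    (h : serAlpha P Q k z = serAlpha P Q k z') : z = z' := by
  obtain ⟨e1, e2⟩ := Prod.mk.inj h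
  exact Prod.ext (P.α_inj k _ _ (serB_gt hz).1 (serB_gt hz').1 e1)
    (Q.α_inj k _ _ (serB_gt hz).2 (serB_gt hz').2 e2)

/-- `serAlpha k` is downward, red `≥ 1`, blue drop `≤ 1` -/
theorem serAlpha_spec (k : ℕ) (z : X × Y) (hz : k < serB b b' z) :
    serAlpha P Q k z ≤ z ∧ 1 ≤ serR r r' (serAlpha P Q k z) ∧ serB b b' z ≤ serB b b' (serAlpha P Q k z) + 1 := by
  obtain ⟨l1, r1, d1⟩ := P.α_spec k _ (serB_gt hz).1
  obtain ⟨l2, r2, d2⟩ := Q.α_spec k _ (serB_gt hz).2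
  refine ⟨Prod.mk_le_mk.2 ⟨l1, l2⟩, ?_, ?_⟩
  · simp only [serAlpha, serR]; omega
  · simp only [serAlpha, serB]; omega

/-- `serAlpha k` avoids the images of the slots of index `< k` -/
theorem serAlpha_avoid (k : ℕ) (z : X × Y) (hz : k < serB b b' z)
    (p : SlotL (USrc (serR r r') (serB b b')) (serB b b')) (hp : p.1.2.val < k) :
    serAlpha P Q k z ≠ serAssignL P Q p := by
  intro he
  rcases hk : alKind r b r' b' p with _ | _ | _
  · rw [serAssignL_zero P Q hk] at he
    obtain ⟨e1, e2⟩ := Prod.mk.inj he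
    have h0 := alKind_zero r b r' b' hk
    rcases ser_src_red r b r' b' p.1.1.2.1 with hu | hv
    · rw [zero_fst_eq P hu] at e1
      exact P.α_avoid k _ (serB_gt hz).1 _ (by simp only [mkSlot_idx]; omega) e1
    · rw [zero_snd_eq Q hv] at e2
      exact Q.α_avoid k _ (serB_gt hz).2 _ (by simp only [mkSlot_idx]; omega) e2
  · rw [serAssignL_src P Q hk] at he
    obtain ⟨e1, -⟩ := Prod.mk.inj he
    exact P.α_avoid k _ (serB_gt hz).1 _ (by simp only [mkSlot_idx]; exact hp) e1
  · rw [serAssignL_int P Q hk] at he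
    obtain ⟨-, e2⟩ := Prod.mk.inj he
    exact Q.α_avoid k _ (serB_gt hz).2 _ (by simp only [mkSlot_idx]; exact hp) e2

/-- `serAlpha 0` agrees with the assignment on the slot `0` of every source -/
theorem serAlpha_src (p : SlotL (USrc (serR r r') (serB b b')) (serB b b')) (hp : p.1.2.val = 0) :
    serAlpha P Q 0 p.1.1.1 = serAssignL P Q p := by
  have hk : alKind r b r' b' p = .zero := by unfold alKind; rw [if_pos hp]
  rw [serAssignL_zero P Q hk]; rfl

/-- `serBeta k` is injective on `{r ≥ 1, b > k}` -/
theorem serBeta_inj (k : ℕ) (z z' : X × Y) (hr : 1 ≤ serR r r' z) (hz : k < serB b b' z)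
    (hr' : 1 ≤ serR r r' z') (hz' : k < serB b b' z') (h : serBeta P Q k z = serBeta P Q k z') : z = z' := by
  obtain ⟨e1, e2⟩ := Prod.mk.inj h
  exact Prod.ext (P.β_inj k _ _ (serR_pos hr).1 (serB_gt hz).1 (serR_pos hr').1 (serB_gt hz').1 e1)
    (Q.β_inj k _ _ (serR_pos hr).2 (serB_gt hz).2 (serR_pos hr').2 (serB_gt hz').2 e2)

/-- `serBeta k` is downward, red `≥ 1`, blue drop `≤ 1` -/
theorem serBeta_spec (k : ℕ) (z : X × Y) (hr : 1 ≤ serR r r' z) (hz : k < serB b b' z) :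
    serBeta P Q k z ≤ z ∧ 1 ≤ serR r r' (serBeta P Q k z) ∧ serB b b' z ≤ serB b b' (serBeta P Q k z) + 1 := by
  obtain ⟨l1, r1, d1⟩ := P.β_spec k _ (serR_pos hr).1 (serB_gt hz).1
  obtain ⟨l2, r2, d2⟩ := Q.β_spec k _ (serR_pos hr).2 (serB_gt hz).2
  refine ⟨Prod.mk_le_mk.2 ⟨l1, l2⟩, ?_, ?_⟩
  · simp only [serBeta, serR]; omega
  · simp only [serBeta, serB]; omega

/-- `serBeta k` avoids the images of the slots of index `≤ k` -/
theorem serBeta_avoid (k : ℕ) (z : X × Y) (hr : 1 ≤ serR r r' z) (hz : k < serB b b' z)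
    (p : SlotL (USrc (serR r r') (serB b b')) (serB b b')) (hp : p.1.2.val ≤ k) :
    serBeta P Q k z ≠ serAssignL P Q p := by
  intro he
  rcases hk : alKind r b r' b' p with _ | _ | _
  · rw [serAssignL_zero P Q hk] at he
    obtain ⟨e1, e2⟩ := Prod.mk.inj he
    rcases ser_src_red r b r' b' p.1.1.2.1 with hu | hv
    · rw [zero_fst_eq P hu] at e1
      exact P.β_avoid k _ (serR_pos hr).1 (serB_gt hz).1 _ (by simp only [mkSlot_idx]; exact Nat.zero_le _) e1
    · rw [zero_snd_eq Q hv] at e2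
      exact Q.β_avoid k _ (serR_pos hr).2 (serB_gt hz).2 _ (by simp only [mkSlot_idx]; exact Nat.zero_le _) e2
  · rw [serAssignL_src P Q hk] at he
    obtain ⟨e1, -⟩ := Prod.mk.inj he
    exact P.β_avoid k _ (serR_pos hr).1 (serB_gt hz).1 _ (by simp only [mkSlot_idx]; exact hp) e1
  · rw [serAssignL_int P Q hk] at he
    obtain ⟨-, e2⟩ := Prod.mk.inj he
    exact Q.β_avoid k _ (serR_pos hr).2 (serB_gt hz).2 _ (by simp only [mkSlot_idx]; exact hp) e2

/-- **the series product of two level-aligned packages** -/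
noncomputable def PackageL.ser : PackageL (serR r r') (serB b b') where
  f := serAssignL P Q
  f_inj := serAssignL_inj P Q
  f_spec := serAssignL_spec P Q
  α := serAlpha P Q
  α_inj := serAlpha_inj P Q
  α_spec := serAlpha_spec P Q
  α_avoid := serAlpha_avoid P Q
  α_src := serAlpha_src P Q
  β := serBeta P Q
  β_inj := serBeta_inj P Q
  β_spec := serBeta_spec P Q
  β_avoid := serBeta_avoid P Q

end Summit.Ventures.PercRepro2.UHClosure
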